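/-
Cell pub-hodgecm2 (COR-CM = stage 2 of the Hodge ladder), seat p2 (binder prover 2/8), gen 22
(prover-pub-hodgecm2-p2-g22-0), 2026-08-21.  Count-neutral own lane PERL-WEIL-LINE (work item W-a of
`hodge-director/B01-SIZE.md` §4 T2), file 2/3: the model JUNCTION in the converse direction.  Theorems only.
HONEST FRAMING: HC_CM is NOT proved; this file transports a hypothesis between two spellings already in the tree.
-/
import Summits.HodgeConjecture.CorCM.Model.WeilFaceAlgebraicOfWeilLineClasses
import Summits.HodgeConjecture.CorCM.Model.ExteriorAlgebraFacts
import Summits.HodgeConjecture.CorCM.Model.PerLConeFacts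
import Summits.HodgeConjecture.CorCM.WeilLineMonomials
import HarnessLib

/-!
# COR-CM model junction, converse direction: `U.weilLine K Φ ≤ U.alg P 2` on the model universe ⟹ the
# `K`-Weil-line classes of the four corner realisations are algebraic on the real carrier

`Model/WeilFaceAlgebraicOfWeilLineClasses.lean` (seat b07) proves, for the model universe of record
`U = Model.universeOf hHD hI hU h₃`, a CM field `K` and four types `Φ`, the arrow
«real-carrier algebraicity of the `K`-Weil-line classes `weilLineClasses (cornerAV …) (cornerAct …) 4` of the
corner realisations ⟹ `U.weilLine K Φ ≤ U.alg (U.prod4 K Φ) 2`» (`Model.weilLine_le_alg_of_weilLineClasses`).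
THIS FILE proves the CONVERSE arrow

* `Model.weilLineClasses_le_algebraicClasses_of_weilLine_le_alg` :
  `U.weilLine K Φ ≤ U.alg (U.prod4 K Φ) 2 → weilLineClasses (cornerAV h₃ K Φ) (cornerAct h₃ K Φ) 4 ≤
  algebraicClasses (⨁ cornerAV h₃ K Φ).X 2`,

so that universe-language OUTPUTS — the surface criterion for quadruples and the PerL consumer
`Universe.weilLine_le_alg_of_perL` of `CorCM/SurfaceCriterionQuadruple.lean` — can be read on the tree's real
carriers (`AbelianVariety ℂ`, `complexBetti`, `algebraicClasses`, `HodgeTheory.weilLineClasses`), where the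
Pohlmann / weight-monomial files of the cell live (`CorCM/WeilLineMonomials.lean`:
`weilLineClasses = ⨆_s ℂ ∙ monomial s`).

Proof (dimension count, no Hodge-type hypothesis needed).  Let `W = U.weilLine K Φ ⊂ H⁴(P; ℚ)`
(`dim_ℚ W = [K:ℚ]`, model row M17 `universeOf_fact_weilLine_rank_of`), `W_ℂ = W ⊗ ℂ ⊂ ℂ ⊗ H⁴(P; ℚ)`
(`dim_ℂ = [K:ℚ]`, flatness `Model.finrank_baseChange_eq'`), and
`T = ofBiprod^* ∘ β : ℂ ⊗ H⁴(P; ℚ) → H⁴((⨁_j A_j)(ℂ); ℂ)` (complexification `β = ofRatClassBaseChange`, then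
pull-back along the comparison isomorphism `ofBiprod : ⨁_j A_j ⟶ ((A₀ × A₁) × A₂) × A₃`).  `T` is injective
(`ofRatClassBaseChange_injective`; `toBiprod ≫ ofBiprod = 𝟙`), `T(W_ℂ) ≤ weilLineClasses` (every complexified Weil
generator pulls back to a `K`-Weil-line class, `FourCorner.map_ofBiprod_gen_mem_weilLineClasses`, exactly as in
b07's file), and `T(W_ℂ) ≤ algebraicClasses` (each `w ∈ W` is in `U.alg = ratAlgebraicClasses`, i.e. `β(w ⊗ 1)`
is algebraic, and pull-backs of algebraic classes along morphisms of abelian varieties are algebraic,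
`map_mem_algebraicClasses_of_abelianVariety`).  Since `dim_ℂ weilLineClasses = [K:ℚ]` (p2-g10
`WeilLineMonomial.finrank_weilLineClasses` on the eigenbases of the corner realisations), `T(W_ℂ) = weilLineClasses`,
which is therefore inside `algebraicClasses`.

References: Deligne, LNM 900 (1982) §4; Milne, *Hodge classes on abelian varieties* (2020) §2; the headers of
`Model/WeilFaceAlgebraicOfWeilLineClasses.lean`, `Model/WeilFaceCorners.lean`, `CorCM/WeilLineRank.lean`.
-/

noncomputable section

open CategoryTheory CategoryTheory.Limits NumberField MonoidalCategory
open scoped TensorProduct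
open Literature.AlgebraicTopology.SingularHomology
open Literature.AlgebraicGeometry.Motives Literature.AlgebraicGeometry.HodgeTheory
open Literature.AlgebraicGeometry.ComplexMultiplication Literature.NumberTheory.Automorphic
open Literature.NumberTheory.Automorphic.PicardCM (CMCode cmRealisation BallQuotientUniformisedDatum
  CMAbelianVarietyRealised)

namespace Summit.HodgeConjecture.CorCM.Model


/-- `ofBiprod^*` is injective on `H⁴` (left inverse `toBiprod^*`, since `toBiprod ≫ ofBiprod = 𝟙`). [folklore] -/
theorem map_ofBiprod_injective (h₃ : CMAbelianVarietyRealised) (K : CMField) (Φ : Fin 4 → CMType K) :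
    Function.Injective (complexBetti.map (FourCorner.ofBiprod (cornerAV h₃ K Φ)).hom.hom.hom 4) := by
  intro x x' h
  have hback : ∀ z : complexBetti (FourCorner.prodAV (cornerAV h₃ K Φ)).X 4,
      complexBetti.map (FourCorner.toBiprod (cornerAV h₃ K Φ)).hom.hom.hom 4
        (complexBetti.map (FourCorner.ofBiprod (cornerAV h₃ K Φ)).hom.hom.hom 4 z) = z := fun z => by
    rw [abelianVarietyHom_map_map_apply, FourCorner.toBiprod_ofBiprod]
    change complexBetti.map (𝟙 (FourCorner.prodAV (cornerAV h₃ K Φ)).X) 4 z = z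
    rw [complexBetti.map_id]
    rfl
  rw [← hback x, ← hback x', h]

/-- **`T(W_ℂ) ≤ weilLineClasses`**: the complexified span of the model's Weil generators of `P = ∏ A_{Φ_j}` is
carried by `ofBiprod^* ∘ β` into the `K`-Weil-line classes of `⨁_j A_{Φ_j}` (b07's route, packaged as a
`Submodule` inequality). [cite: Milne2020HodgeClassesAV, §2.1–2.2] -/
theorem span_weilGenerators_le_comap_weilLineClasses (hHD : exists_isReal_hodgeModel) (hI : hodgePQ_independent_of_hodgeModel)
    (hU : BallQuotientUniformisedDatum) (h₃ : CMAbelianVarietyRealised) (K : CMField) (Φ : Fin 4 → CMType K) :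
    Submodule.span ℂ ((universeOf hHD hI hU h₃).weilGenerators K Φ) ≤
      ((weilLineClasses (cornerAV h₃ K Φ) (cornerAct h₃ K Φ) 4).comap
        (complexBetti.map (FourCorner.ofBiprod (cornerAV h₃ K Φ)).hom.hom.hom 4).hom).comap
        (ofRatClassBaseChange (ComplexPoints (FourCorner.prodAV (cornerAV h₃ K Φ)).X) 4) := by
  rw [Submodule.span_le]
  intro g hg
  obtain ⟨σ, y, hy, hβ⟩ := ofRatClassBaseChange_weilGenerator hHD hI hU h₃ K Φ hg
  have key := FourCorner.map_ofBiprod_gen_mem_weilLineClasses (cornerAV h₃ K Φ) (cornerAct h₃ K Φ) σ _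
    (fun j a => map_cornerAct_ofRatClassBaseChange hHD hI hU h₃ K Φ j σ (hy j) a)
  rw [← hβ] at key
  exact key

/-- **The `K`-Weil-line classes of the corner realisations have `ℂ`-dimension `[K:ℚ]`** (p2-g10
`WeilLineMonomial.finrank_weilLineClasses` on eigenbases of the realisations `A_{(K,Φ_j)}` read over `K`).
[cite: Milne2020HodgeClassesAV, §2.1–2.2] -/
theorem finrank_weilLineClasses_corner (h₃ : CMAbelianVarietyRealised) (K : CMField) (Φ : Fin 4 → CMType K) :
    Module.finrank ℂ (weilLineClasses (cornerAV h₃ K Φ) (cornerAct h₃ K Φ) 4) = Module.finrank ℚ K := by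
  have hA := fun j => cornerAV_isCMTypeRealisation h₃ K Φ j
  choose v hv using fun j => AndreProductForm.exists_eigenbasis (hA j)
  exact WeilLineMonomial.finrank_weilLineClasses hA hv (by norm_num)

/-- **Converse model junction.**  For the model universe `U = Model.universeOf hHD hI hU h₃`, a CM field `K` and
four CM types `Φ`: IF the model's Weil line `W_K(P) ⊂ H⁴(P; ℚ)` of `P = A_{Φ₀} × A_{Φ₁} × A_{Φ₂} × A_{Φ₃}` consists
of algebraic classes (`U.weilLine K Φ ≤ U.alg (U.prod4 K Φ) 2` — the conclusion shape of the surface criterion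
and of `Universe.weilLine_le_alg_of_perL`), THEN every `K`-Weil-line class
`t ∈ weilLineClasses (cornerAV h₃ K Φ) (cornerAct h₃ K Φ) 4 ⊂ H⁴((⨁_j A_{Φ_j})(ℂ); ℂ)` of the corner
realisations is algebraic.  Dimension count: `T(W ⊗ ℂ)` (`T = ofBiprod^* ∘ β` injective) is a
`[K:ℚ]`-dimensional subspace of the `[K:ℚ]`-dimensional `weilLineClasses`, spanned by algebraic classes.
[cite: Deligne1982HodgeCycles, §4] [cite: Milne2020HodgeClassesAV, Theorem 1 (proof)] -/
theorem weilLineClasses_le_algebraicClasses_of_weilLine_le_alg (hHD : exists_isReal_hodgeModel) (hI : hodgePQ_independent_of_hodgeModel)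
    (hU : BallQuotientUniformisedDatum) (h₃ : CMAbelianVarietyRealised) (K : CMField) (Φ : Fin 4 → CMType K)
    (hW : (universeOf hHD hI hU h₃).weilLine K Φ ≤
      (universeOf hHD hI hU h₃).alg ((universeOf hHD hI hU h₃).prod4 K Φ) 2) :
    weilLineClasses (cornerAV h₃ K Φ) (cornerAct h₃ K Φ) 4 ≤ algebraicClasses (⨁ cornerAV h₃ K Φ).X 2 := by
  -- the players: `β` = complexification, `ob` = pull-back along `ofBiprod`, `T = ob ∘ β`, `W` = the Weil line
  set U := universeOf hHD hI hU h₃ with hUdef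
  set W : Submodule ℚ (U.Coh (U.prod4 K Φ) 4) := U.weilLine K Φ with hWdef
  set WL := weilLineClasses (cornerAV h₃ K Φ) (cornerAct h₃ K Φ) 4 with hWLdef
  set T : U.CohC (U.prod4 K Φ) 4 →ₗ[ℂ] complexBetti (⨁ cornerAV h₃ K Φ).X 4 :=
    (complexBetti.map (FourCorner.ofBiprod (cornerAV h₃ K Φ)).hom.hom.hom 4).hom ∘ₗ
      ofRatClassBaseChange (ComplexPoints (FourCorner.prodAV (cornerAV h₃ K Φ)).X) 4 with hTdef
  haveI : FiniteDimensional ℚ (U.Coh (U.prod4 K Φ) 4) := U.instFinite _ _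
  -- (1) `T` is injective
  have hT : Function.Injective T := by
    intro x x' h
    exact ofRatClassBaseChange_injective _ 4 (map_ofBiprod_injective h₃ K Φ h)
  -- (2) `dim_ℂ T(W ⊗ ℂ) = [K:ℚ]`
  have hWrank : Module.finrank ℚ W = Module.finrank ℚ K :=
    universeOf_fact_weilLine_rank_of hHD hI hU h₃ (universeOf_fact_eigenLine hHD hI hU h₃)
      (universeOf_fact_H1_rank hHD hI hU h₃) K Φ
  have hTW : Module.finrank ℂ ((W.baseChange ℂ).map T) = Module.finrank ℚ K := by
    rw [← (Submodule.equivMapOfInjective T hT (W.baseChange ℂ)).finrank_eq, finrank_baseChange_eq' W, hWrank]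
  -- (3) `T(W ⊗ ℂ) ≤ weilLineClasses`
  have h3 : (W.baseChange ℂ).map T ≤ WL := by
    rw [Submodule.map_le_iff_le_comap, Submodule.baseChange_eq_span, Submodule.span_le]
    rintro _ ⟨w, hw, rfl⟩
    have hw' : (HodgeStructure.ofRat w : U.CohC (U.prod4 K Φ) 4) ∈ Submodule.span ℂ (U.weilGenerators K Φ) := hw
    exact span_weilGenerators_le_comap_weilLineClasses hHD hI hU h₃ K Φ hw'
  -- (4) `T(W ⊗ ℂ) ≤ algebraicClasses`
  have h4 : (W.baseChange ℂ).map T ≤ algebraicClasses (⨁ cornerAV h₃ K Φ).X 2 := by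
    rw [Submodule.map_le_iff_le_comap, Submodule.baseChange_eq_span, Submodule.span_le]
    rintro _ ⟨w, hw, rfl⟩
    have halg : ofRatClass (ComplexPoints (FourCorner.prodAV (cornerAV h₃ K Φ)).X) (2 * 2) w ∈
        algebraicClasses (FourCorner.prodAV (cornerAV h₃ K Φ)).X 2 :=
      (PicardCM.mem_ratAlgebraicClasses_iff _ 2 w).1 (hW hw)
    have hβw : ofRatClassBaseChange (ComplexPoints (FourCorner.prodAV (cornerAV h₃ K Φ)).X) 4
        (HodgeStructure.ofRat w : U.CohC (U.prod4 K Φ) 4) =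
        ofRatClass (ComplexPoints (FourCorner.prodAV (cornerAV h₃ K Φ)).X) (2 * 2) w :=
      (ofRatClassBaseChange_tmul (Y := ComplexPoints (FourCorner.prodAV (cornerAV h₃ K Φ)).X) (k := 4)
        (1 : ℂ) w).trans (one_smul ℂ _)
    have hmem := map_mem_algebraicClasses_of_abelianVariety (p := 2)
      (AbelianVariety.isSmoothProjective_holds (A := ⨁ cornerAV h₃ K Φ))
      (FourCorner.prodAV (cornerAV h₃ K Φ)) (FourCorner.ofBiprod (cornerAV h₃ K Φ)).hom.hom.hom halg
    rw [← hβw] at hmem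
    exact hmem
  -- (5) dimension of `weilLineClasses`, (6) conclusion
  have h5 : Module.finrank ℂ WL = Module.finrank ℚ K := finrank_weilLineClasses_corner h₃ K Φ
  haveI : FiniteDimensional ℂ WL :=
    Module.finite_of_finrank_pos (by rw [h5]; exact Module.finrank_pos)
  have heq : (W.baseChange ℂ).map T = WL :=
    Submodule.eq_of_le_of_finrank_eq h3 (by rw [hTW, h5])
  exact heq.symm.trans_le h4

/-- The same in the shape `2 * 2` of the binder `hW` of `Model.weilLine_le_alg_of_weilLineClasses` /
`AndreProductForm.mem_algebraicClasses_cmTypedProduct` at `p = 2`: every `K`-Weil-line class (rationality and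
Hodge type are not even needed) of the corner realisations is algebraic. [cite: Milne2020HodgeClassesAV, Theorem 1 (proof)] -/
theorem mem_algebraicClasses_of_mem_weilLineClasses_of_weilLine_le_alg (hHD : exists_isReal_hodgeModel) (hI : hodgePQ_independent_of_hodgeModel)
    (hU : BallQuotientUniformisedDatum) (h₃ : CMAbelianVarietyRealised) (K : CMField) (Φ : Fin 4 → CMType K)
    (hW : (universeOf hHD hI hU h₃).weilLine K Φ ≤
      (universeOf hHD hI hU h₃).alg ((universeOf hHD hI hU h₃).prod4 K Φ) 2)
    {t : complexBetti (⨁ cornerAV h₃ K Φ).X (2 * 2)}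
    (ht : t ∈ weilLineClasses (cornerAV h₃ K Φ) (cornerAct h₃ K Φ) (2 * 2)) :
    t ∈ algebraicClasses (⨁ cornerAV h₃ K Φ).X 2 :=
  weilLineClasses_le_algebraicClasses_of_weilLine_le_alg hHD hI hU h₃ K Φ hW ht

/-- **The two spellings are EQUIVALENT on the model** (this file's converse with b07's
`Model.weilLine_le_alg_of_weilLineClasses`, given the Hodge property `hH` of the Weil line, e.g. from
`Universe.weilLine_le_hodgeClassesOf_of_sumTwo`): `U.weilLine K Φ ≤ U.alg P 2 ↔ weilLineClasses ≤ algebraicClasses`.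
[cite: Milne2020HodgeClassesAV, Theorem 1 (proof)] -/
theorem weilLine_le_alg_iff_weilLineClasses_le_algebraicClasses (hHD : exists_isReal_hodgeModel) (hI : hodgePQ_independent_of_hodgeModel)
    (hU : BallQuotientUniformisedDatum) (h₃ : CMAbelianVarietyRealised) (K : CMField) (Φ : Fin 4 → CMType K)
    (hH : (universeOf hHD hI hU h₃).weilLine K Φ ≤
      (universeOf hHD hI hU h₃).hodgeClassesOf ((universeOf hHD hI hU h₃).prod4 K Φ) 2) :
    (universeOf hHD hI hU h₃).weilLine K Φ ≤ (universeOf hHD hI hU h₃).alg ((universeOf hHD hI hU h₃).prod4 K Φ) 2 ↔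
      weilLineClasses (cornerAV h₃ K Φ) (cornerAct h₃ K Φ) 4 ≤ algebraicClasses (⨁ cornerAV h₃ K Φ).X 2 :=
  ⟨weilLineClasses_le_algebraicClasses_of_weilLine_le_alg hHD hI hU h₃ K Φ,
    fun h => weilLine_le_alg_of_weilLineClasses hHD hI hU h₃ K Φ (fun _ _ _ ht => h ht) hH⟩

end Summit.HodgeConjecture.CorCM.Model

end
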